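import Summits.QuantumFields.YangMills.Theorems.BalabanUVNodesN12GuardedLinAvgRightInverse
import Literature.MathematicalPhysics.QuantumFieldTheory.Balaban1983to89.Node00.LinearisedAveragingEquivariant

/-!
# BalabanUVNodes ∕ N12 — module G2: THE (45)–(46) RIGHT INVERSE IS TRANSPORTED ALONG GAUGE TRANSFORMATIONS — surjectivity of `X ↦ (π(qLin j_i U X c_i))_i` is a
# GAUGE-INVARIANT property of the background (n07-w1's guard-free covariance `qLin_gaugeAct_of_all`), so module F's near-flat right inverse exists at EVERY background
# GAUGE-EQUIVALENT to a configuration with `‖↑U − 1‖ < ρ′`, with the same letter; and along index maps (restriction to sub-index sets)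

Cell `pub-ymgap` (HUMAN RULINGS D-0062 ∕ D-0149), width seat `pub-ymgap-dag-n10-w1` g2; sequel of module F (`…N12GuardedLinAvgRightInverse`, p605814 ✓).  Key K1⁷
`stmt-QuantumFields-20542`, `--kind proof --supports … --as helper`; count-neutral; THEOREMS ONLY (0 `def`, 0 `sorry`, 0 `instance`, 0 `notation`).  CONSUMED BY NAME, nothing
modified: module F (`exists_radius_rightInverse_suProj_qLin`), n07-w1's `Node00.LinearisedAveragingEquivariant` (★ `qLin_gaugeAct_of_all` — `qLin k U^u (Ad_{u∘tgt}X) c =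
ū(c₊)·qLin k U X c·ū(c₊)⋆`, guard-free; `toMS`), n07-w2's `Node00.MultiScaleFibreChart` (`suProj`, `suPart`, `coe_suProj`), `T4AdjointCovarianceUnitary` (`specialUnitaryAd`,
`norm_specialUnitaryAd`, `opNorm_conj_unitary`), `Setup` (`GaugeField.gaugeAct`).

THE PRINT.  [Balaban1985Variational] (153) p. 301: *«Q_k(U₀^u)(R(u)X) = R(ū)(Q_k(U₀)X)»* (gauge covariance of the linearised averaging), (44)–(46) p. 285 (the right inverse `H`);
[Balaban1985Averaging] (11)–(13) p. 19 (covariance of the averaging); [Balaban1985BackgroundPropagators] (3.29) p. 395.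

CONTENTS.  §1 `suPart_conj` ∕ ★ `suProj_conj` — `π(gAg⋆) = Ad(g)(π A)` for `g ∈ SU(N)` and EVERY matrix `A` (trace-free anti-Hermitian part commutes with unitary conjugation; no
membership hypothesis); `gaugeAct_inv_gaugeAct'` (`(U^u)^{u⁻¹} = U`, two lines over `Setup.gaugeAct`).  §2 `exists_twists`, `pi_norm_congr` (plumbing), ★★ `exists_rightInverse_gaugeAct` — THE TRANSPORT: a real-linear right inverse
`H` of `X ↦ (π(qLin (lv i) U X (bd i)))_i` yields one at `U^u`, namely `y ↦ Ad_{u∘tgt}(H((Ad_{ū_i}⁻¹ y_i)_i))`, `ū_i = (toMS u (lv i))((bd i)₊)`, WITH THE SAME op-sup letter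
(`Ad` is an isometry of `𝔰𝔲(N)` and unitary conjugation preserves the operator norm); `surjective_gaugeAct_iff`-shape corollary `exists_rightInverse_iff_gaugeAct`.  §3 ★★★
`exists_radius_rightInverse_suProj_qLin_gauge` — module F up to gauge: ONE `ρ′ > 0` (F's, from `k` and the letter constant `B`) such that for EVERY finite index of levels `≤ k`,
EVERY flat right inverse `H₁` with letter `≤ B`, EVERY background `U` and EVERY gauge transformation `u` with `‖↑(U^u) − 1‖ < ρ′`: a real-linear right inverse at `U` with
letter `2B` — print's (45)–(46) at every background GAUGE-EQUIVALENT TO A NEAR-FLAT ONE.  §4 `exists_extendByZero`, ★ `exists_rightInverse_of_indexMap` — transport along an index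
map with a left inverse (a right inverse on `ι`-data restricts to any sub-index set, same letter; for the `BondIdx D` → `constrEnum 𝐁` dictionary once named).

HONEST FRAMING.  Algebraic bookkeeping by name over module F and n07-w1's covariance; which backgrounds admit a near-flat gauge (small plaquette variables + trivial
holonomies, an axial gauge of the background) is NOT decided here — the hypothesis `‖↑(U^u) − 1‖ < ρ′` is DISPLAYED; the flat right inverse `H₁` is displayed (module F′
discharges it for admissible families at the record); `ρ′` EXISTS by module D∕E's smoothness constants (print's `O(L²α₀)` radius NOT claimed); nothing of Bałaban's analysis
asserted; N12 ∕ N07 NOT discharged; K1⁷ NOT closed; count-neutral (typed 28∕28 · discharged 5∕27 unmoved); one finite 𝕋⁴ programme at fixed ε — R4 closes the conditional rung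
`BalabanLadder.UV` only; the YM mass gap (Clay) is NOT proved by any of this.  No `sorry`, no `def`, no `instance`, no `notation`.
-/

noncomputable section

open scoped BigOperators Matrix.Norms.L2Operator

namespace Summit.QuantumFields.YangMills.BalabanUVNodes.N12GuardedLinAvgRightInverseGauge

open Literature.MathematicalPhysics.QuantumFieldTheory.Balaban1983to89
open T4AdjointCovarianceUnitary (lieSU specialUnitaryAd coe_specialUnitaryAd norm_specialUnitaryAd opNorm_conj_unitary specialUnitaryAd_inv_apply)
open B16Sect1Backgrounds (toMS)
open Node00
open Summit.QuantumFields.YangMills.BalabanUVNodes.N12GuardedLinAvgRightInverse (exists_radius_rightInverse_suProj_qLin)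

variable {P : Params} {N : ℕ}

/-! ## §1  `π` commutes with unitary conjugation; `(U^u)^{u⁻¹} = U` -/

/-- `π(gAg⋆) = g·π(A)·g⋆` for `g ∈ SU(N)` and every matrix `A` (`(gAg⋆)⋆ = gA⋆g⋆`, `tr(gSg⋆) = tr S`, `g1g⋆ = 1`). [folklore] -/
theorem suPart_conj (g : Matrix.specialUnitaryGroup (Fin N) ℂ) (A : Matrix (Fin N) (Fin N) ℂ) :
    suPart ((g : Matrix (Fin N) (Fin N) ℂ) * A * star (g : Matrix (Fin N) (Fin N) ℂ)) =
      (g : Matrix (Fin N) (Fin N) ℂ) * suPart A * star (g : Matrix (Fin N) (Fin N) ℂ) := by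
  set G : Matrix (Fin N) (Fin N) ℂ := (g : Matrix (Fin N) (Fin N) ℂ) with hG
  have hGG : star G * G = 1 := by rw [hG]; exact Unitary.star_mul_self_of_mem (Matrix.specialUnitaryGroup_le_unitaryGroup g.2)
  have hGG' : G * star G = 1 := by rw [hG]; exact Unitary.mul_star_self_of_mem (Matrix.specialUnitaryGroup_le_unitaryGroup g.2)
  set S : Matrix (Fin N) (Fin N) ℂ := A - star A with hS
  have hskew : G * A * star G - star (G * A * star G) = G * S * star G := by
    rw [hS, star_mul, star_mul, star_star]; noncomm_ring
  have htr : ((2 : ℂ)⁻¹ • (G * S * star G)).trace = ((2 : ℂ)⁻¹ • S).trace := by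
    rw [Matrix.trace_smul, Matrix.trace_smul, Matrix.trace_mul_cycle, hGG, Matrix.one_mul]
  set c : ℂ := ((2 : ℂ)⁻¹ • S).trace / (N : ℂ) with hc
  have key : G * ((2 : ℂ)⁻¹ • S - c • (1 : Matrix (Fin N) (Fin N) ℂ)) * star G = (2 : ℂ)⁻¹ • (G * S * star G) - c • (1 : Matrix (Fin N) (Fin N) ℂ) := by
    rw [Matrix.mul_sub, Matrix.sub_mul, Matrix.mul_smul, Matrix.smul_mul, Matrix.mul_smul, Matrix.smul_mul, Matrix.mul_one, hGG']
  show (2 : ℂ)⁻¹ • (G * A * star G - star (G * A * star G)) - (((2 : ℂ)⁻¹ • (G * A * star G - star (G * A * star G))).trace / (N : ℂ)) • 1 =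
    G * ((2 : ℂ)⁻¹ • S - c • 1) * star G
  rw [hskew, htr, key]

/-- `(U^u)^{u⁻¹} = U` for `Setup.gaugeAct` (`u⁻¹` pointwise). [cite: Balaban1985Averaging, (8) p.19 (bookkeeping)] -/
theorem gaugeAct_inv_gaugeAct' {G : Type*} [GaugeGroup G] {j : ℕ} (u : GaugeTransf P j G) (U : GaugeField P j G) :
    GaugeField.gaugeAct (fun x => (u x)⁻¹) (GaugeField.gaugeAct u U) = U := by
  funext b; simp only [GaugeField.gaugeAct, inv_inv]; group

variable [NeZero N]

omit [NeZero N] in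
/-- ★ **`π(gAg⋆) = Ad(g)(π A)`** in `𝔰𝔲(N)` for `g ∈ SU(N)` and every matrix `A` — no membership hypothesis on `A`. [folklore] -/
theorem suProj_conj (g : SU N) (A : Matrix (Fin N) (Fin N) ℂ) :
    suProj N ((g : Matrix (Fin N) (Fin N) ℂ) * A * star (g : Matrix (Fin N) (Fin N) ℂ)) = specialUnitaryAd g (suProj N A) := by
  apply Subtype.ext
  rw [coe_suProj, coe_specialUnitaryAd, coe_suProj, suPart_conj]

/-! ## §2  Transport of a right inverse along a gauge transformation -/

omit [NeZero N] in
/-- The PRE-twist `y ↦ (Ad(ū_i)⁻¹ y_i)_i` and the POST-twist `X ↦ (Ad(u(b₊)) X_b)_b` as real-linear maps (terms inside proofs; no `def`). [cite: Balaban1985Variational, (153) p.301 (bookkeeping)] -/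
theorem exists_twists {ι : Type*} (g : ι → SU N) (u : GaugeTransf P 0 (SU N)) :
    (∃ Tw : (ι → lieSU (Fin N)) →ₗ[ℝ] (ι → lieSU (Fin N)), ∀ y i, Tw y i = specialUnitaryAd (g i)⁻¹ (y i)) ∧
    (∃ Ad : (PBond P 0 → lieSU (Fin N)) →ₗ[ℝ] (PBond P 0 → lieSU (Fin N)), ∀ X b, Ad X b = specialUnitaryAd (u b.tgt) (X b)) := by
  refine ⟨⟨{ toFun := fun y i => specialUnitaryAd (g i)⁻¹ (y i),
             map_add' := fun y y' => funext fun i => by simp only [Pi.add_apply, map_add],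
             map_smul' := fun a y => funext fun i => by simp only [Pi.smul_apply, LinearIsometryEquiv.map_smul, RingHom.id_apply] },
           fun _ _ => rfl⟩,
          ⟨{ toFun := fun X b => specialUnitaryAd (u b.tgt) (X b),
             map_add' := fun X X' => funext fun b => by simp only [Pi.add_apply, map_add],
             map_smul' := fun a X => funext fun b => by simp only [Pi.smul_apply, LinearIsometryEquiv.map_smul, RingHom.id_apply] },
           fun _ _ => rfl⟩⟩

omit [NeZero N] in
/-- Two fields with bondwise equal operator norms have the same op-sup norm; two `𝔰𝔲(N)`-data with componentwise equal norms have the same sup norm. [folklore] -/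
theorem pi_norm_congr {ι : Type*} [Fintype ι] {E : Type*} [SeminormedAddCommGroup E] {E' : Type*} [SeminormedAddCommGroup E'] (f : ι → E) (g : ι → E')
    (h : ∀ i, ‖f i‖ = ‖g i‖) : ‖f‖ = ‖g‖ := by
  have h' : ∀ i, ‖f i‖₊ = ‖g i‖₊ := fun i => by ext; rw [coe_nnnorm, coe_nnnorm]; exact h i
  rw [Pi.norm_def, Pi.norm_def]
  congr 1
  exact Finset.sup_congr rfl fun i _ => h' i

/-- ★★ **TRANSPORT OF A RIGHT INVERSE ALONG A GAUGE TRANSFORMATION, WITH THE LETTER.**  If `H` is a real-linear right inverse of `X ↦ (π(qLin (lv i) U X (bd i)))_i` with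
op-sup letter `‖↑(H y)‖ ≤ B‖y‖`, then `H^u : y ↦ Ad_{u∘tgt}(H((Ad(ū_i)⁻¹ y_i)_i))`, `ū_i = (toMS u (lv i))((bd i)₊)`, is a real-linear right inverse at the transformed background
`U^u` with the SAME letter: `π(qLin (lv i) U^u (H^u y) (bd i)) = y i` (n07-w1's guard-free covariance `qLin_gaugeAct_of_all` + §1 `suProj_conj`; `Ad` is an isometry of
`𝔰𝔲(N)`, unitary conjugation preserves the operator norm). [cite: Balaban1985Variational, (153) p.301, (44)-(46) p.285; Balaban1985Averaging, (11)-(13) p.19] -/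
theorem exists_rightInverse_gaugeAct {ι : Type*} [Fintype ι] (lv : ι → ℕ) (bd : (i : ι) → PBond P (lv i)) (U : GaugeField P 0 (SU N)) (u : GaugeTransf P 0 (SU N))
    (H : (ι → lieSU (Fin N)) →ₗ[ℝ] (PBond P 0 → lieSU (Fin N))) (hH : ∀ y i, suProj N (qLin (lv i) U (H y) (bd i)) = y i)
    {B : ℝ} (hB : ∀ y, ‖(fun b => (H y b : Matrix (Fin N) (Fin N) ℂ))‖ ≤ B * ‖y‖) :
    ∃ H' : (ι → lieSU (Fin N)) →ₗ[ℝ] (PBond P 0 → lieSU (Fin N)),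
      (∀ y b, H' y b = specialUnitaryAd (u b.tgt) (H (fun i => specialUnitaryAd (toMS u (lv i) (bd i).tgt)⁻¹ (y i)) b)) ∧
      (∀ y i, suProj N (qLin (lv i) (GaugeField.gaugeAct u U) (H' y) (bd i)) = y i) ∧
      ∀ y, ‖(fun b => (H' y b : Matrix (Fin N) (Fin N) ℂ))‖ ≤ B * ‖y‖ := by
  obtain ⟨⟨Tw, hTw⟩, ⟨Ad, hAd⟩⟩ := exists_twists (P := P) (fun i => toMS u (lv i) (bd i).tgt) u
  have hTwf : ∀ y, Tw y = fun i => specialUnitaryAd (toMS u (lv i) (bd i).tgt)⁻¹ (y i) := fun y => funext (hTw y)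
  have hfun : ∀ y, (Ad ∘ₗ H ∘ₗ Tw) y = fun b => specialUnitaryAd (u b.tgt) (H (Tw y) b) := fun y => funext fun b => by
    rw [LinearMap.comp_apply, LinearMap.comp_apply, hAd]
  refine ⟨Ad ∘ₗ H ∘ₗ Tw, fun y b => by rw [hfun, hTwf], fun y i => ?_, fun y => ?_⟩
  · rw [hfun, qLin_gaugeAct_of_all, suProj_conj, hH, hTw]
    simpa only [inv_inv] using specialUnitaryAd_inv_apply (toMS u (lv i) (bd i).tgt)⁻¹ (y i)
  · have hpost : ‖(fun b => ((Ad ∘ₗ H ∘ₗ Tw) y b : Matrix (Fin N) (Fin N) ℂ))‖ = ‖(fun b => (H (Tw y) b : Matrix (Fin N) (Fin N) ℂ))‖ :=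
      pi_norm_congr _ _ fun b => by
        rw [hfun, coe_specialUnitaryAd]
        exact opNorm_conj_unitary ⟨_, Matrix.specialUnitaryGroup_le_unitaryGroup (u b.tgt).2⟩ _
    have hpre : ‖Tw y‖ = ‖y‖ := pi_norm_congr _ _ fun i => by rw [hTw]; exact norm_specialUnitaryAd _ _
    rw [hpost, ← hpre]
    exact hB (Tw y)

/-- **Right inverses at `U` and at `U^u` correspond** (existence level): the transport of `exists_rightInverse_gaugeAct` and the inverse transport along `u⁻¹`.
[cite: Balaban1985Variational, (153) p.301, (45) p.285] -/
theorem exists_rightInverse_iff_gaugeAct {ι : Type*} [Fintype ι] (lv : ι → ℕ) (bd : (i : ι) → PBond P (lv i)) (U : GaugeField P 0 (SU N)) (u : GaugeTransf P 0 (SU N)) :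
    (∃ H : (ι → lieSU (Fin N)) →ₗ[ℝ] (PBond P 0 → lieSU (Fin N)), ∀ y i, suProj N (qLin (lv i) U (H y) (bd i)) = y i) ↔
      ∃ H : (ι → lieSU (Fin N)) →ₗ[ℝ] (PBond P 0 → lieSU (Fin N)), ∀ y i, suProj N (qLin (lv i) (GaugeField.gaugeAct u U) (H y) (bd i)) = y i := by
  constructor
  · rintro ⟨H, hH⟩
    obtain ⟨B, -, hB⟩ := N12GuardedLinAvgRightInverse.exists_letter_of_linear (P := P) (N := N) H
    obtain ⟨H', -, hH', -⟩ := exists_rightInverse_gaugeAct lv bd U u H hH hB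
    exact ⟨H', hH'⟩
  · rintro ⟨H, hH⟩
    obtain ⟨B, -, hB⟩ := N12GuardedLinAvgRightInverse.exists_letter_of_linear (P := P) (N := N) H
    obtain ⟨H', -, hH', -⟩ := exists_rightInverse_gaugeAct lv bd (GaugeField.gaugeAct u U) (fun x => (u x)⁻¹) H hH hB
    refine ⟨H', fun y i => ?_⟩
    have h := hH' y i
    rwa [gaugeAct_inv_gaugeAct' u U] at h

/-! ## §3  Module F up to gauge: the right inverse at every background gauge-equivalent to a near-flat one -/

/-- ★★★ **PRINT's (45)–(46) AT EVERY BACKGROUND GAUGE-EQUIVALENT TO A NEAR-FLAT ONE, ONE RADIUS, WITH THE LETTER.**  For levels `≤ k` and a letter constant `B ≥ 0`, module F's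
`ρ′ > 0` serves: for EVERY finite index (`lv i ≤ k`, bonds `bd i`), EVERY real-linear flat right inverse `H₁` (`π(qLin (lv i) 1 (H₁ y) (bd i)) = y i`) with letter `‖↑(H₁ y)‖ ≤ B‖y‖`,
EVERY background `U` and EVERY gauge transformation `u` with `‖↑(U^u) − 1‖ < ρ′`, there is a real-linear right inverse `H` AT `U` — `π(qLin (lv i) U (H y) (bd i)) = y i` — with
letter `‖↑(H y)‖ ≤ 2B‖y‖` (module F at the near-flat representative `U^u`, transported back along `u⁻¹` by §2). [cite: Balaban1985Variational, (44)-(46) p.285, (153) p.301; Balaban1985Averaging, (11)-(13) p.19, Prop. 3 (121)-(125) p.36] -/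
theorem exists_radius_rightInverse_suProj_qLin_gauge (k : ℕ) {B : ℝ} (hB0 : 0 ≤ B) :
    ∃ ρ' : ℝ, 0 < ρ' ∧ ∀ {ι : Type*} [Fintype ι] (lv : ι → ℕ) (_ : ∀ i, lv i ≤ k) (bd : (i : ι) → PBond P (lv i))
      (H₁ : (ι → lieSU (Fin N)) →ₗ[ℝ] (PBond P 0 → lieSU (Fin N)))
      (_ : ∀ y i, suProj N (qLin (lv i) (1 : GaugeField P 0 (SU N)) (H₁ y) (bd i)) = y i)
      (_ : ∀ y, ‖(fun b => (H₁ y b : Matrix (Fin N) (Fin N) ℂ))‖ ≤ B * ‖y‖)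
      (U : GaugeField P 0 (SU N)) (u : GaugeTransf P 0 (SU N)), ‖coeField (GaugeField.gaugeAct u U) - 1‖ < ρ' →
      ∃ H : (ι → lieSU (Fin N)) →ₗ[ℝ] (PBond P 0 → lieSU (Fin N)),
        (∀ y i, suProj N (qLin (lv i) U (H y) (bd i)) = y i) ∧ ∀ y, ‖(fun b => (H y b : Matrix (Fin N) (Fin N) ℂ))‖ ≤ 2 * B * ‖y‖ := by
  obtain ⟨ρ', hρ', h⟩ := exists_radius_rightInverse_suProj_qLin (P := P) (N := N) k hB0
  refine ⟨ρ', hρ', fun {ι} _ lv hlv bd H₁ h₁ hB U u hU => ?_⟩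
  obtain ⟨G, hG, -, hGB⟩ := h lv hlv bd H₁ h₁ hB (GaugeField.gaugeAct u U) hU
  have hGB' : ∀ y, ‖(fun b => ((H₁ ∘ₗ G) y b : Matrix (Fin N) (Fin N) ℂ))‖ ≤ (2 * B) * ‖y‖ := fun y => by
    rw [LinearMap.comp_apply]; exact hGB y
  have hG' : ∀ y i, suProj N (qLin (lv i) (GaugeField.gaugeAct u U) ((H₁ ∘ₗ G) y) (bd i)) = y i := fun y i => by
    rw [LinearMap.comp_apply]; exact hG y i
  obtain ⟨H', -, hH', hB'⟩ := exists_rightInverse_gaugeAct lv bd (GaugeField.gaugeAct u U) (fun x => (u x)⁻¹) (H₁ ∘ₗ G) hG' hGB'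
  refine ⟨H', fun y i => ?_, hB'⟩
  have h := hH' y i
  rwa [gaugeAct_inv_gaugeAct' u U] at h

/-! ## §4  Transport along an index map: a right inverse on a larger index set restricts to a sub-index set -/

omit [NeZero N] in
/-- Extension by zero along an index map `e : ι′ → ι` with a left inverse `r` (so `e` is injective), as a real-linear map of `𝔰𝔲(N)`-data with `(ext y′)(e i′) = y′ i′` and sup norm
`‖ext y′‖ ≤ ‖y′‖` (a term inside proofs; no `def`). [folklore] -/
theorem exists_extendByZero {ι ι' : Type*} [Fintype ι] [Fintype ι'] [DecidableEq ι] (e : ι' → ι) (r : ι → ι') (hre : ∀ i', r (e i') = i') :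
    ∃ ext : (ι' → lieSU (Fin N)) →ₗ[ℝ] (ι → lieSU (Fin N)), (∀ y' i', ext y' (e i') = y' i') ∧ ∀ y', ‖ext y'‖ ≤ ‖y'‖ := by
  refine ⟨{ toFun := fun y' i => if e (r i) = i then y' (r i) else 0,
            map_add' := fun y y' => funext fun i => by by_cases h : e (r i) = i <;> simp [h],
            map_smul' := fun a y => funext fun i => by by_cases h : e (r i) = i <;> simp [h] }, fun y' i' => ?_, fun y' => ?_⟩
  · show (if e (r (e i')) = e i' then y' (r (e i')) else 0) = y' i'
    rw [hre, if_pos rfl]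
  · refine (pi_norm_le_iff_of_nonneg (norm_nonneg _)).2 fun i => ?_
    show ‖(if e (r i) = i then y' (r i) else 0)‖ ≤ ‖y'‖
    by_cases h : e (r i) = i
    · rw [if_pos h]; exact norm_le_pi_norm y' (r i)
    · rw [if_neg h, norm_zero]; exact norm_nonneg _

omit [NeZero N] in
/-- ★ **TRANSPORT ALONG AN INDEX MAP, WITH THE LETTER**: a real-linear right inverse `H` of `X ↦ (π(qLin (lv i) U X (bd i)))_{i ∈ ι}` with op-sup letter `B ≥ 0` restricts, along any
index map `e : ι′ → ι` with a left inverse, to a right inverse of `X ↦ (π(qLin (lv (e i′)) U X (bd (e i′))))_{i′ ∈ ι′}` with the same letter (`H ∘ ext`, extension by zero) — e.g. from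
the index bonds `BondIdx D` of an admissible family to the enumerated constrained bonds of a determining set they contain, once that dictionary is named. [cite: Balaban1985Variational, (45) p.285 (bookkeeping)] -/
theorem exists_rightInverse_of_indexMap {ι ι' : Type*} [Fintype ι] [Fintype ι'] [DecidableEq ι] (e : ι' → ι) (r : ι → ι') (hre : ∀ i', r (e i') = i')
    (lv : ι → ℕ) (bd : (i : ι) → PBond P (lv i)) (U : GaugeField P 0 (SU N))
    (H : (ι → lieSU (Fin N)) →ₗ[ℝ] (PBond P 0 → lieSU (Fin N))) (hH : ∀ y i, suProj N (qLin (lv i) U (H y) (bd i)) = y i)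
    {B : ℝ} (hB0 : 0 ≤ B) (hB : ∀ y, ‖(fun b => (H y b : Matrix (Fin N) (Fin N) ℂ))‖ ≤ B * ‖y‖) :
    ∃ H' : (ι' → lieSU (Fin N)) →ₗ[ℝ] (PBond P 0 → lieSU (Fin N)),
      (∀ y' i', suProj N (qLin (lv (e i')) U (H' y') (bd (e i'))) = y' i') ∧ ∀ y', ‖(fun b => (H' y' b : Matrix (Fin N) (Fin N) ℂ))‖ ≤ B * ‖y'‖ := by
  obtain ⟨ext, hext, hnorm⟩ := exists_extendByZero (N := N) e r hre
  refine ⟨H ∘ₗ ext, fun y' i' => by rw [LinearMap.comp_apply, hH, hext], fun y' => ?_⟩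
  rw [LinearMap.comp_apply]
  exact (hB (ext y')).trans (mul_le_mul_of_nonneg_left (hnorm y') hB0)

end Summit.QuantumFields.YangMills.BalabanUVNodes.N12GuardedLinAvgRightInverseGauge

end
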